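import Summits.ResolutionOfSingularities.ResolutionOfSingularities.Theorems.HilbertSamuelEliminationSigmaMaxModificationsCorridor3WLadderIsoProximityDefs
import Summits.ResolutionOfSingularities.ResolutionOfSingularities.Theorems.HilbertSamuelEliminationCampaignW42ProjDirectrixOfDirDimEq
import Literature.AlgebraicGeometry.Resolution.PointBlowupHsFunMono
import Mathlib.AlgebraicGeometry.AlgClosed.Basic
import Mathlib.FieldTheory.Perfect
import HarnessLib

/-!
# [OURS · L1 W4.2] THE ISO-KERNEL RESIDUAL AT PERFECT / ALGEBRAICALLY CLOSED ORIGINS: (k2) and K2 ARE ARITHMETIC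

Crux chain w42 (`SigmaMaxModifications`, stmt-ResolutionOfSingularities-18506; conjunct `SigmaMaxModificationsCorridor3`,
stmt-…-19249), line `w_ladder`, registered stub `stub_isoKernelResidual` of skeleton v8.4 (`IsoInsepTowerTerminates p 3 ∧
IsoSepJumpRecurrentImpossible p 3 ∧ IsoSepSatelliteRecurrentImpossible p 3`, the residual of the isolated kernel
`IsoQuadraticTowerTerminates p 3` once K1 `IsoFreeRationalTailsImpossible p 3` is in). Lead res-L1-w42-lead-1 (gen 5). Helper file
`--supports stmt-ResolutionOfSingularities-19249`; kernel only (no definition, no named fact).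

WHAT IS PROVED (bookkeeping over the tree, no new mathematics): along an isolated E3 point tower (`IsIsoPointTower`, res-type-012 p500943)
every step `κ(x_n) → κ(x_{n+1})` is a FINITE field extension (closed points, blow-ups are locally of finite type — Stacks 01TB in the tree's
form `finite_residueFieldMap_of_isClosed`); hence

* (§2) a PERFECT residue field at the origin stays perfect along the tower (`Algebra.IsAlgebraic.perfectField`), and at a point with perfect
  residue field `e = ē` (`CampaignW42.dirDim_eq_geomDirDim_of_perfectField`, Dietel's ridge comparison), so NO stage is an
  inseparable-directrix stage: the row (k2) `IsoInsepTowerTerminates` is EMPTY over perfect origins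
  (`not_isInsepStage_of_perfectField`, `forall_not_isInsepStage_of_perfectField_origin`);
* (§3) an ALGEBRAICALLY CLOSED residue field at the origin stays algebraically closed and every step is RATIONAL
  (`IsAlgClosed.ringHom_bijective_of_isIntegral`): the jump rows K2 / K2-sep are EMPTY over algebraically closed origins
  (`forall_isRationalStep_of_isAlgClosed_origin`);
* (§4) consequently the isolated kernel AT AN ORIGIN WITH ALGEBRAICALLY CLOSED RESIDUE FIELD follows from K1 and K3-sep alone
  (`false_of_isIsoPointTower_of_isAlgClosed`), and at an origin with PERFECT residue field from K1, K2-sep and K3-sep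
  (`false_of_isIsoPointTower_of_perfectField`) — the (k2) conjunct of `stub_isoKernelResidual` is an IMPERFECT-residue-field phenomenon
  (Cossart–Piltant's (Dis) case) and the K2-sep conjunct a NON-algebraically-closed one; the geometric core of the kernel is K3-sep
  (satellite-recurrent towers, the class of quadratic sequences along rank-2 valuations).

HONEST FRAMING. OURS bookkeeping for the census of the registered stub; nothing here is a statement of H. Hironaka's manuscript
[Hironaka2017] nor of [CossartJannsenSaito2020] / [CossartPiltant2009] (pointers only). AI-written; AI review is weaker than expert review.

References: The Stacks Project, Tag 01TB [StacksProject]; B. Dietel, *A refinement of Hironaka's additive group schemes for an extended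
invariant*, thesis Regensburg (2015), Lemma (6.3.5) (ii) [Dietel2015]; V. Cossart, O. Piltant, J. Algebra 321 (2009), ch. 3 I.8.3 (ix), I.10
[CossartPiltant2009]; V. Cossart, U. Jannsen, S. Saito, LNM 2270 (2020), Def. 2.26, Def. 6.38 [CossartJannsenSaito2020].
-/

noncomputable section

set_option linter.dupNamespace false

open CategoryTheory AlgebraicGeometry TopologicalSpace IsLocalRing
open Summit.ResolutionOfSingularities.ResolutionOfSingularities.Theorems.CampaignW42
open Summit.ResolutionOfSingularities.ResolutionOfSingularities.Theorems.SigmaMaxModificationsCorridor3.Moving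
open Literature.AlgebraicGeometry.Resolution Literature.AlgebraicGeometry.CossartJannsenSaito2020
open Summit.ResolutionOfSingularities.ResolutionOfSingularities.Cruxes.SigmaMaxModifications.IdeasL1Idea2R4
  (IsIsoPointTower IsoQuadraticTowerTerminates)

namespace Summit.ResolutionOfSingularities.ResolutionOfSingularities.Cruxes.SigmaMaxModifications.IdeasL1C5

universe u

variable {N : ℕ} {ν : ℕ → ℕ} {T : BlowupTower.{u}} {pt : ∀ n, T.X n}

/-! ## §1. Residue fields along an isolated point tower: every step is a finite extension -/

/-- Along an isolated point tower every step `κ(π_n x_{n+1}) → κ(x_{n+1})` is a FINITE field extension: `x_{n+1}` is a closed point and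
the blow-up `π_n` is locally of finite type (Stacks 01TB). [cite: StacksProject, Tag 01TB] -/
theorem finite_residueFieldMap_of_isIsoPointTower (hT : IsIsoPointTower N ν T pt) (n : ℕ) :
    ((T.π n).residueFieldMap (pt (n + 1))).hom.Finite := by
  haveI := T.ln n
  haveI := T.ln (n + 1)
  haveI : IsProper (T.π n) := (T.isBlowup n).isProper
  exact finite_residueFieldMap_of_isClosed (T.π n) (hT.2.2.1 (n + 1))

/-- … hence an INTEGRAL ring map. [cite: StacksProject, Tag 01TB] -/
theorem isIntegral_residueFieldMap_of_isIsoPointTower (hT : IsIsoPointTower N ν T pt) (n : ℕ) :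
    ((T.π n).residueFieldMap (pt (n + 1))).hom.IsIntegral :=
  (finite_residueFieldMap_of_isIsoPointTower hT n).to_isIntegral

/-! ## §2. Perfect residue fields: no inseparable-directrix stage ((k2) is empty over perfect origins) -/

/-- A PERFECT residue field at the origin stays perfect along an isolated point tower (an algebraic extension of a perfect field is
perfect). [folklore] -/
theorem perfectField_residueField_of_isIsoPointTower (hT : IsIsoPointTower N ν T pt)
    (h0 : PerfectField (ResidueField ((T.X 0).presheaf.stalk (pt 0)))) (n : ℕ) :
    PerfectField (ResidueField ((T.X n).presheaf.stalk (pt n))) := by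
  induction n with
  | zero => exact h0
  | succ n ih =>
    have hb : PerfectField (ResidueField ((T.X n).presheaf.stalk ((T.π n).base (pt (n + 1))))) := by
      rw [hT.2.1 n]; exact ih
    let f : ResidueField ((T.X n).presheaf.stalk ((T.π n).base (pt (n + 1)))) →+*
        ResidueField ((T.X (n + 1)).presheaf.stalk (pt (n + 1))) := ((T.π n).residueFieldMap (pt (n + 1))).hom
    have hf : f.IsIntegral := isIntegral_residueFieldMap_of_isIsoPointTower hT n
    letI : Algebra (ResidueField ((T.X n).presheaf.stalk ((T.π n).base (pt (n + 1)))))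
        (ResidueField ((T.X (n + 1)).presheaf.stalk (pt (n + 1)))) := f.toAlgebra
    haveI : Algebra.IsIntegral (ResidueField ((T.X n).presheaf.stalk ((T.π n).base (pt (n + 1)))))
        (ResidueField ((T.X (n + 1)).presheaf.stalk (pt (n + 1)))) := ⟨hf⟩
    exact Algebra.IsAlgebraic.perfectField (ResidueField ((T.X n).presheaf.stalk ((T.π n).base (pt (n + 1)))))

/-- At a stage whose marked point has PERFECT residue field the directrix is separable: `e = ē`, so the stage is NOT an
inseparable-directrix stage. [cite: Dietel2015, Lemma (6.3.5) (ii)] [cite: CossartJannsenSaito2020, Def. 2.26] -/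
theorem not_isInsepStage_of_perfectField (n : ℕ) (hperf : PerfectField (ResidueField ((T.X n).presheaf.stalk (pt n)))) :
    ¬ IsInsepStage T pt n := by
  letI := T.ln n
  have h := dirDim_eq_geomDirDim_of_perfectField (X := T.X n) (pt n) hperf
  unfold IsInsepStage
  rw [h]
  exact lt_irrefl _

/-- **(k2) IS EMPTY OVER PERFECT ORIGINS**: along an isolated point tower whose origin has perfect residue field, NO stage is an
inseparable-directrix stage. [cite: Dietel2015, Lemma (6.3.5) (ii)] [cite: CossartPiltant2009, ch. 3 I.10] -/
theorem forall_not_isInsepStage_of_perfectField_origin (hT : IsIsoPointTower N ν T pt)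
    (h0 : PerfectField (ResidueField ((T.X 0).presheaf.stalk (pt 0)))) : ∀ n, ¬ IsInsepStage T pt n :=
  fun n => not_isInsepStage_of_perfectField n (perfectField_residueField_of_isIsoPointTower hT h0 n)

/-! ## §3. Algebraically closed residue fields: every step is rational (K2 is empty over algebraically closed origins) -/

/-- An ALGEBRAICALLY CLOSED residue field at the origin stays algebraically closed along an isolated point tower, and every step is
RATIONAL (an integral extension of an algebraically closed field is trivial). [folklore] -/
theorem isAlgClosed_and_isRationalStep_of_isIsoPointTower (hT : IsIsoPointTower N ν T pt)
    (h0 : IsAlgClosed (ResidueField ((T.X 0).presheaf.stalk (pt 0)))) (n : ℕ) :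
    IsAlgClosed (ResidueField ((T.X n).presheaf.stalk (pt n))) ∧ ∀ m, m < n → IsRationalStep T pt m := by
  induction n with
  | zero => exact ⟨h0, fun m hm => absurd hm (Nat.not_lt_zero m)⟩
  | succ n ih =>
    have hb : IsAlgClosed (ResidueField ((T.X n).presheaf.stalk ((T.π n).base (pt (n + 1))))) := by
      rw [hT.2.1 n]; exact ih.1
    let f : ResidueField ((T.X n).presheaf.stalk ((T.π n).base (pt (n + 1)))) →+*
        ResidueField ((T.X (n + 1)).presheaf.stalk (pt (n + 1))) := ((T.π n).residueFieldMap (pt (n + 1))).hom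
    have hf : f.IsIntegral := isIntegral_residueFieldMap_of_isIsoPointTower hT n
    have hbij : Function.Bijective f := IsAlgClosed.ringHom_bijective_of_isIntegral f hf
    refine ⟨IsAlgClosed.of_ringEquiv _ _ (RingEquiv.ofBijective _ hbij), fun m hm => ?_⟩
    rcases Nat.lt_succ_iff_lt_or_eq.1 hm with hm | rfl
    · exact ih.2 m hm
    · exact hbij.2

/-- **K2 IS EMPTY OVER ALGEBRAICALLY CLOSED ORIGINS**: along an isolated point tower whose origin has algebraically closed residue
field EVERY step is rational (no residue-degree jump ever). [cite: CossartPiltant2009, ch. 3 I.8.3 (ix)] -/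
theorem forall_isRationalStep_of_isAlgClosed_origin (hT : IsIsoPointTower N ν T pt)
    (h0 : IsAlgClosed (ResidueField ((T.X 0).presheaf.stalk (pt 0)))) : ∀ n, IsRationalStep T pt n :=
  fun n => (isAlgClosed_and_isRationalStep_of_isIsoPointTower hT h0 (n + 1)).2 n n.lt_succ_self

/-! ## §4. The isolated kernel at perfect / algebraically closed origins from K1, K2-sep, K3-sep -/

/-- **THE KERNEL AT A PERFECT ORIGIN FROM K1 ∧ K2-sep ∧ K3-sep** (no (k2) needed): an isolated E3 point tower over a maximal origin with
perfect residue field is eventually separable (§2); K2-sep and K3-sep then make it eventually free-rational, which K1 forbids.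
[cite: CossartPiltant2009, ch. 3 I.9] [cite: CossartJannsenSaito2020, Def. 6.38] -/
theorem false_of_isIsoPointTower_of_perfectField {p : ℕ} (h1 : IsoFreeRationalTailsImpossible.{u} p N)
    (h2 : IsoSepJumpRecurrentImpossible.{u} p N) (h3 : IsoSepSatelliteRecurrentImpossible.{u} p N)
    (hO : IsMaximalOrigin p N ν (T.X 0) (pt 0)) (hT : IsIsoPointTower N ν T pt)
    (h0 : PerfectField (ResidueField ((T.X 0).presheaf.stalk (pt 0)))) : False := by
  have hsep : ∃ n₀, ∀ n, n₀ ≤ n → ¬ IsInsepStage T pt n :=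
    ⟨0, fun n _ => forall_not_isInsepStage_of_perfectField_origin hT h0 n⟩
  have hj := h2 ν T pt hO hT hsep
  have hs := h3 ν T pt hO hT hsep
  push Not at hj hs
  obtain ⟨n₁, hn₁⟩ := hj
  obtain ⟨n₂, hn₂⟩ := hs
  exact h1 ν T pt hO hT ⟨max n₁ n₂, fun n hn =>
    ⟨hn₁ n (le_of_max_le_left hn), hn₂ n (le_of_max_le_right hn)⟩⟩

/-- **THE KERNEL AT AN ALGEBRAICALLY CLOSED ORIGIN FROM K1 ∧ K3-sep ALONE** (neither (k2) nor K2 needed): every step is rational and no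
stage is an inseparable-directrix stage (§2, §3), so K3-sep makes the tower eventually free-rational, which K1 forbids.
[cite: CossartPiltant2009, ch. 3 I.9, ch. 4 II.4] [cite: CossartJannsenSaito2020, Def. 6.38] -/
theorem false_of_isIsoPointTower_of_isAlgClosed {p : ℕ} (h1 : IsoFreeRationalTailsImpossible.{u} p N)
    (h3 : IsoSepSatelliteRecurrentImpossible.{u} p N)
    (hO : IsMaximalOrigin p N ν (T.X 0) (pt 0)) (hT : IsIsoPointTower N ν T pt)
    (h0 : IsAlgClosed (ResidueField ((T.X 0).presheaf.stalk (pt 0)))) : False := by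
  have hsep : ∃ n₀, ∀ n, n₀ ≤ n → ¬ IsInsepStage T pt n :=
    ⟨0, fun n _ => forall_not_isInsepStage_of_perfectField_origin hT inferInstance n⟩
  have hs := h3 ν T pt hO hT hsep
  push Not at hs
  obtain ⟨n₂, hn₂⟩ := hs
  exact h1 ν T pt hO hT ⟨n₂, fun n hn => ⟨forall_isRationalStep_of_isAlgClosed_origin hT h0 n, hn₂ n hn⟩⟩

/-! ## §5. Ground fields: closed points of schemes locally of finite type over a perfect / algebraically closed field -/

/-- The residue field of a CLOSED point of a scheme locally of finite type over a PERFECT field `k` is perfect (it is a finite extension of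
`k`: `Spec κ(x) → Spec k` is locally of finite type between Jacobson schemes, hence finite, Stacks 01TB). [cite: StacksProject, Tag 01TB] -/
theorem perfectField_residueField_of_isClosed {X : Scheme.{u}} {k : Type u} [Field k] [PerfectField k]
    (f : X ⟶ Spec (.of k)) [LocallyOfFiniteType f] {x : X} (hx : IsClosed ({x} : Set X)) :
    PerfectField (X.residueField x) := by
  have hfin : IsFinite (X.fromSpecResidueField x ≫ f) := by
    rw [isClosed_singleton_iff_isClosedImmersion] at hx
    rw [isFinite_iff_locallyOfFiniteType_of_jacobsonSpace]
    infer_instance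
  let φ : k →+* X.residueField x := (Spec.preimage (X.fromSpecResidueField x ≫ f)).hom
  have hφ : φ.IsIntegral := by
    change (Spec.preimage (X.fromSpecResidueField x ≫ f)).hom.IsIntegral
    rw [← IsIntegralHom.SpecMap_iff, Spec.map_preimage]
    infer_instance
  letI : Algebra k (X.residueField x) := φ.toAlgebra
  haveI : Algebra.IsIntegral k (X.residueField x) := ⟨hφ⟩
  exact Algebra.IsAlgebraic.perfectField k

/-- **THE KERNEL OVER AN ALGEBRAICALLY CLOSED GROUND FIELD FROM K1 ∧ K3-sep**: if the origin stage is locally of finite type over an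
algebraically closed field (every maximal origin is of finite type over SOME field; this is the case where that field is algebraically
closed — the regime of every specimen of record), an isolated E3 point tower over it is impossible as soon as K1 and K3-sep hold (Mathlib
`residueFieldIsoBase`: the residue field of the closed origin IS `k`). [cite: CossartPiltant2009, ch. 3 I.9, ch. 4 II.4] -/
theorem false_of_isIsoPointTower_over_isAlgClosed {p : ℕ} (h1 : IsoFreeRationalTailsImpossible.{u} p N)
    (h3 : IsoSepSatelliteRecurrentImpossible.{u} p N) {k : Type u} [Field k] [IsAlgClosed k]
    (f : T.X 0 ⟶ Spec (.of k)) [LocallyOfFiniteType f]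
    (hO : IsMaximalOrigin p N ν (T.X 0) (pt 0)) (hT : IsIsoPointTower N ν T pt) : False :=
  false_of_isIsoPointTower_of_isAlgClosed h1 h3 hO hT
    (IsAlgClosed.of_ringEquiv k _ (residueFieldIsoBase f (pt 0) (hT.2.2.1 0)).commRingCatIsoToRingEquiv.symm)

/-- **THE KERNEL OVER A PERFECT GROUND FIELD FROM K1 ∧ K2-sep ∧ K3-sep** (no (k2)): the same over a perfect field (finite fields, algebraic
closures of `𝔽_p`, …). [cite: CossartPiltant2009, ch. 3 I.9, I.8.3 (ix), ch. 4 II.4] -/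
theorem false_of_isIsoPointTower_over_perfectField {p : ℕ} (h1 : IsoFreeRationalTailsImpossible.{u} p N)
    (h2 : IsoSepJumpRecurrentImpossible.{u} p N) (h3 : IsoSepSatelliteRecurrentImpossible.{u} p N)
    {k : Type u} [Field k] [PerfectField k] (f : T.X 0 ⟶ Spec (.of k)) [LocallyOfFiniteType f]
    (hO : IsMaximalOrigin p N ν (T.X 0) (pt 0)) (hT : IsIsoPointTower N ν T pt) : False :=
  false_of_isIsoPointTower_of_perfectField h1 h2 h3 hO hT (perfectField_residueField_of_isClosed f (hT.2.2.1 0))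

end Summit.ResolutionOfSingularities.ResolutionOfSingularities.Cruxes.SigmaMaxModifications.IdeasL1C5

end
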